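import Summits.QuantumAdvantage.QuantumAdvantage.Theorems.NearExactIsExact.Negative.CaseADigitNotAffineFourteen
import Summits.QuantumAdvantage.QuantumAdvantage.Theorems.NearExactIsExact.Negative.CaseARankTwoFourteen
import Summits.QuantumAdvantage.QuantumAdvantage.Theorems.CubicForrelationNearExactIsExactEightSymplectic
import Summits.QuantumAdvantage.QuantumAdvantage.Theorems.CubicForrelationNearExactIsExactFourteenDigits
import Summits.QuantumAdvantage.QuantumAdvantage.Theorems.CubicForrelationSignedExactCubicForrelationNotPrBPPStubNoTrapTransportLemmas
import Summits.QuantumAdvantage.QuantumAdvantage.Theorems.CubicForrelationNearExactIsExactUniformRowDefect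

/-!
# The case-A digit on 14 bits is `p·q ⊕ (affine)` (frame-free structure lemma for THEOREM CA-W; NearExactIsExact, disprover gen 23)

Negative/structural lemmas for the crux `CubicForrelation.NearExactIsExact` (item r2), finite slice `n = 14`;
ONE-SIDED (no partner `f`) and FRAME-FREE.  HONEST FRAMING: a theorem about a single cubic Boolean function on 14 bits
— NOT summit progress; no violation of `NearExactIsExact`, no per-`n` value.

Setting: `g` cubic on `14` bits with `W_g = 32u`, all `u(x)` odd ("type O") and case A (`[⌊u/2⌋ odd] ≠ [⌊u/4⌋ odd]`
everywhere).  The digit `d = [⌊u/2⌋ odd]` is quadratic (`fd_digitOne`) with symplectic form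
`B(a,b) = d(0) ⊕ d(a) ⊕ d(b) ⊕ d(a ⊕ b)`; its radical has `≥ 2¹²` elements (`caseA_radical_large`) and `d` is not affine
(`caseA_digit_not_affine`).  `caseA_pq_structure` packages the consequence used by the frame-free assembly of THEOREM CA-W:
there are `e₀, e₁` with `B(e₀,e₁) = 1` such that
* `B(a,b) = B(a,e₁)B(b,e₀) ⊕ B(a,e₀)B(b,e₁)` for all `a, b` (so `Rad B = ker B(·,e₀) ∩ ker B(·,e₁)`, rank exactly `2`), and
* `μ := d ⊕ B(·,e₁)·B(·,e₀)` has degree `≤ 1`, i.e. `d = p·q ⊕ μ` with the linear functionals `p = B(·,e₁)`, `q = B(·,e₀)`.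
The symplectic-algebra steps are proved for an abstract alternating biadditive form `B` on `𝔽₂ⁿ` (`pq_*` lemmas).

Sources: [this work]; alternating forms over `𝔽₂` / Dickson normal form [cite Carlet2020 §5.2], [cite MacWilliamsSloane1977
Ch. 15 Thm 4].  Standard axioms only.
-/

set_option linter.dupNamespace false -- D-0017: single-problem summit ⇒ `QuantumAdvantage.QuantumAdvantage` by design

noncomputable section

namespace Summit.QuantumAdvantage.QuantumAdvantage.Theorems.NearExactIsExact.Negative.CaseAPQStructureFourteen

open Finset
open Literature.Computability.QuantumComplexity
open Literature.Computability.QuantumComplexity.BuzetChailloux (bxor zeroVec bxor_self zeroVec_bxor)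
open Literature.Computability.QuantumComplexity.DerivativeWalsh (W)
open Summit.QuantumAdvantage.QuantumAdvantage.Theorems.CubicForrelation.NearExactIsExact
open Summit.QuantumAdvantage.QuantumAdvantage.Theorems.SignedExactCubicForrelationNotPrBPP.Covariance
  (isDegLeFun_one_of_additive)
open Summit.QuantumAdvantage.QuantumAdvantage.Theorems.NearExactIsExact.Negative.CaseARankTwoFourteen
  (cr_card_params caseA_radical_large)
open Summit.QuantumAdvantage.QuantumAdvantage.Theorems.NearExactIsExact.Negative.CaseADigitNotAffineFourteen
  (caseA_digit_not_affine)

variable {n : ℕ}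

/-! ### Abstract alternating biadditive forms on `𝔽₂ⁿ` -/

/-- A biadditive form vanishes on the zero vector: `B(0,b) = 0`. [folklore] -/
theorem pq_B_zero_left (B : (Fin n → Bool) → (Fin n → Bool) → Bool)
    (hadd : ∀ a a' b, B (bxor a a') b = (B a b ^^ B a' b)) (b : Fin n → Bool) : B zeroVec b = false := by
  have h := hadd zeroVec zeroVec b
  rw [bxor_self] at h
  revert h
  cases B zeroVec b <;> decide

/-- **Involution halving.** If `a ↦ a ⊕ e` preserves `S` and complements `φ` on `S`, then exactly half of `S` has `φ = 0`.
[folklore] -/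
theorem pq_involution_half (S : Finset (Fin n → Bool)) (φ : (Fin n → Bool) → Bool) (e : Fin n → Bool)
    (hS : ∀ a ∈ S, bxor a e ∈ S) (hφ : ∀ a ∈ S, φ (bxor a e) = !φ a) :
    2 * #(S.filter fun a => φ a = false) = #S := by
  have h1 : #(S.filter fun a => φ a = false) = #(S.filter fun a => ¬ φ a = false) := by
    refine card_bij' (fun a _ => bxor a e) (fun a _ => bxor a e) (fun a ha => ?_) (fun a ha => ?_)
      (fun a _ => ur_bxor_cancel_right a e) (fun a _ => ur_bxor_cancel_right a e)
    · rw [mem_filter] at ha ⊢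
      refine ⟨hS a ha.1, ?_⟩
      rw [hφ a ha.1, ha.2]
      decide
    · rw [mem_filter] at ha ⊢
      refine ⟨hS a ha.1, ?_⟩
      have h : φ a = true := by simpa using ha.2
      rw [hφ a ha.1, h]
      decide
  have h2 := Finset.card_filter_add_card_filter_not (s := S) (fun a => φ a = false)
  omega

/-- **Kernel of a hyperbolic pair.** For an alternating biadditive form `B` with `B(e₀,e₁) = 1`, the common kernel
`K = ker B(·,e₁) ∩ ker B(·,e₀)` has exactly `2ⁿ/4` elements. [cite MacWilliamsSloane1977 Ch. 15] -/
theorem pq_four_mul_card_K (B : (Fin n → Bool) → (Fin n → Bool) → Bool) (hsymm : ∀ a b, B a b = B b a)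
    (hself : ∀ a, B a a = false) (hadd : ∀ a a' b, B (bxor a a') b = (B a b ^^ B a' b))
    (e₀ e₁ : Fin n → Bool) (he : B e₀ e₁ = true) :
    4 * #(univ.filter fun a : Fin n → Bool => B a e₁ = false ∧ B a e₀ = false) = 2 ^ n := by
  have he' : B e₁ e₀ = true := by rw [hsymm]; exact he
  -- first halving: `a ↦ a ⊕ e₀` complements `B(·,e₁)` on the whole space
  have hP : 2 * #(univ.filter fun a : Fin n → Bool => B a e₁ = false) = 2 ^ n := by
    rw [← cr_card_params n]
    refine pq_involution_half univ (fun a => B a e₁) e₀ (fun a _ => mem_univ _) fun a _ => ?_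
    show B (bxor a e₀) e₁ = !B a e₁
    rw [hadd, he]
    cases B a e₁ <;> rfl
  -- second halving: `a ↦ a ⊕ e₁` preserves `ker B(·,e₁)` and complements `B(·,e₀)` there
  have hK : 2 * #((univ.filter fun a : Fin n → Bool => B a e₁ = false).filter fun a => B a e₀ = false) =
      #(univ.filter fun a : Fin n → Bool => B a e₁ = false) := by
    refine pq_involution_half _ (fun a => B a e₀) e₁ (fun a ha => ?_) fun a _ => ?_
    · rw [mem_filter] at ha ⊢
      refine ⟨mem_univ _, ?_⟩
      rw [hadd, hself, ha.2]
      rfl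
    · show B (bxor a e₁) e₀ = !B a e₀
      rw [hadd, he']
      cases B a e₀ <;> rfl
  rw [filter_filter] at hK
  omega

/-- **The common kernel is the radical** when the radical has `≥ 2ⁿ/4` elements: then every `r` with
`B(r,e₀) = B(r,e₁) = 0` is `B`-orthogonal to everything. [this work] -/
theorem pq_K_subset_Rad (B : (Fin n → Bool) → (Fin n → Bool) → Bool) (hsymm : ∀ a b, B a b = B b a)
    (hself : ∀ a, B a a = false) (hadd : ∀ a a' b, B (bxor a a') b = (B a b ^^ B a' b))
    (e₀ e₁ : Fin n → Bool) (he : B e₀ e₁ = true)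
    (hRad : 2 ^ n ≤ 4 * #(univ.filter fun a : Fin n → Bool => ∀ b, B a b = false)) :
    ∀ r, B r e₀ = false → B r e₁ = false → ∀ b, B r b = false := by
  have hK := pq_four_mul_card_K B hsymm hself hadd e₀ e₁ he
  have hsub : (univ.filter fun a : Fin n → Bool => ∀ b, B a b = false) ⊆
      (univ.filter fun a : Fin n → Bool => B a e₁ = false ∧ B a e₀ = false) := by
    intro a ha
    rw [mem_filter] at ha ⊢
    exact ⟨mem_univ _, ha.2 e₁, ha.2 e₀⟩
  have heq := eq_of_subset_of_card_le hsub (by omega)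
  intro r hr₀ hr₁ b
  have hr : r ∈ (univ.filter fun a : Fin n → Bool => B a e₁ = false ∧ B a e₀ = false) :=
    mem_filter.2 ⟨mem_univ _, hr₁, hr₀⟩
  rw [← heq, mem_filter] at hr
  exact hr.2 b

/-- **Rank-2 expansion of the form.** Under the hypotheses of `pq_K_subset_Rad`:
`B(a,b) = B(a,e₁)B(b,e₀) ⊕ B(a,e₀)B(b,e₁)` — every vector is `B`-congruent modulo the radical to its projection
`B(a,e₁)·e₀ ⊕ B(a,e₀)·e₁` onto the hyperbolic plane. [this work] -/
theorem pq_B_eq (B : (Fin n → Bool) → (Fin n → Bool) → Bool) (hsymm : ∀ a b, B a b = B b a)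
    (hself : ∀ a, B a a = false) (hadd : ∀ a a' b, B (bxor a a') b = (B a b ^^ B a' b))
    (e₀ e₁ : Fin n → Bool) (he : B e₀ e₁ = true)
    (hRad : 2 ^ n ≤ 4 * #(univ.filter fun a : Fin n → Bool => ∀ b, B a b = false)) (a b : Fin n → Bool) :
    B a b = ((B a e₁ && B b e₀) ^^ (B a e₀ && B b e₁)) := by
  have hKR := pq_K_subset_Rad B hsymm hself hadd e₀ e₁ he hRad
  have he' : B e₁ e₀ = true := by rw [hsymm]; exact he
  have h00 := hself e₀
  have h11 := hself e₁
  cases hp : B a e₁ <;> cases hc : B a e₀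
  · -- `a` itself lies in the kernel
    rw [hKR a hc hp b]
    rfl
  · -- `a ⊕ e₁` lies in the kernel
    have k₀ : B (bxor a e₁) e₀ = false := by rw [hadd, hc, he']; rfl
    have k₁ : B (bxor a e₁) e₁ = false := by rw [hadd, hp, h11]; rfl
    have h := hKR _ k₀ k₁ b
    rw [hadd, hsymm e₁ b] at h
    revert h
    cases B a b <;> cases B b e₁ <;> cases B b e₀ <;> decide
  · -- `a ⊕ e₀` lies in the kernel
    have k₀ : B (bxor a e₀) e₀ = false := by rw [hadd, hc, h00]; rfl
    have k₁ : B (bxor a e₀) e₁ = false := by rw [hadd, hp, he]; rfl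
    have h := hKR _ k₀ k₁ b
    rw [hadd, hsymm e₀ b] at h
    revert h
    cases B a b <;> cases B b e₁ <;> cases B b e₀ <;> decide
  · -- `a ⊕ e₀ ⊕ e₁` lies in the kernel
    have k₀ : B (bxor (bxor a e₀) e₁) e₀ = false := by rw [hadd, hadd, hc, h00, he']; rfl
    have k₁ : B (bxor (bxor a e₀) e₁) e₁ = false := by rw [hadd, hadd, hp, he, h11]; rfl
    have h := hKR _ k₀ k₁ b
    rw [hadd, hadd, hsymm e₀ b, hsymm e₁ b] at h
    revert h
    cases B a b <;> cases B b e₁ <;> cases B b e₀ <;> decide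

/-- **Removing the hyperbolic part leaves an affine function.** If the form of `q` is `B(a,b) = P(a)Q(b) ⊕ Q(a)P(b)` with
`P, Q` additive, then `μ = q ⊕ P·Q` satisfies `μ(a ⊕ b) ⊕ μ(a) ⊕ μ(b) ⊕ μ(0) = 0`. [this work] -/
theorem pq_mu_additive (q P Q : (Fin n → Bool) → Bool) (hP : ∀ a b, P (bxor a b) = (P a ^^ P b))
    (hQ : ∀ a b, Q (bxor a b) = (Q a ^^ Q b))
    (hBeq : ∀ a b, (q zeroVec ^^ q a ^^ q b ^^ q (bxor a b)) = ((P a && Q b) ^^ (Q a && P b))) (a b : Fin n → Bool) :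
    ((q (bxor a b) ^^ (P (bxor a b) && Q (bxor a b))) ^^ (q zeroVec ^^ (P zeroVec && Q zeroVec))) =
      (((q a ^^ (P a && Q a)) ^^ (q zeroVec ^^ (P zeroVec && Q zeroVec))) ^^
        ((q b ^^ (P b && Q b)) ^^ (q zeroVec ^^ (P zeroVec && Q zeroVec)))) := by
  have hP0 : P zeroVec = false := by
    have h := hP zeroVec zeroVec
    rw [bxor_self] at h
    revert h
    cases P zeroVec <;> decide
  have hQ0 : Q zeroVec = false := by
    have h := hQ zeroVec zeroVec
    rw [bxor_self] at h
    revert h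
    cases Q zeroVec <;> decide
  have h := hBeq a b
  rw [hP a b, hQ a b, hP0, hQ0]
  revert h
  cases q zeroVec <;> cases q a <;> cases q b <;> cases q (bxor a b) <;> cases P a <;> cases P b <;> cases Q a <;>
    cases Q b <;> decide

/-- Under the hypotheses of `pq_mu_additive`, `μ = q ⊕ P·Q` has algebraic degree `≤ 1`. [this work] -/
theorem pq_mu_isDegLeFun_one (q P Q : (Fin n → Bool) → Bool) (hP : ∀ a b, P (bxor a b) = (P a ^^ P b))
    (hQ : ∀ a b, Q (bxor a b) = (Q a ^^ Q b))
    (hBeq : ∀ a b, (q zeroVec ^^ q a ^^ q b ^^ q (bxor a b)) = ((P a && Q b) ^^ (Q a && P b))) :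
    IsDegLeFun 1 (fun a => q a ^^ (P a && Q a)) := by
  have h1 : IsDegLeFun 1 (fun a => (q a ^^ (P a && Q a)) ^^ (q zeroVec ^^ (P zeroVec && Q zeroVec))) :=
    isDegLeFun_one_of_additive fun a b => pq_mu_additive q P Q hP hQ hBeq a b
  have h2 := fc_deg_bxor h1 (isDegLeFun_const 1 (q zeroVec ^^ (P zeroVec && Q zeroVec)))
  have heq : (fun a => ((q a ^^ (P a && Q a)) ^^ (q zeroVec ^^ (P zeroVec && Q zeroVec))) ^^
      (q zeroVec ^^ (P zeroVec && Q zeroVec))) = fun a => q a ^^ (P a && Q a) := by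
    funext a
    cases q a ^^ (P a && Q a) <;> cases q zeroVec ^^ (P zeroVec && Q zeroVec) <;> rfl
  rw [heq] at h2
  exact h2

/-! ### The case-A digit at `n = 14` -/

/-- **Frame-free structure of the case-A digit.** For a cubic `g` on `14` bits with `W_g = 32u`, all `u(x)` odd and
`[⌊u/2⌋ odd] ≠ [⌊u/4⌋ odd]` everywhere, with `d(a) = [⌊u(a)/2⌋ odd]` and `B(a,b) = d(0) ⊕ d(a) ⊕ d(b) ⊕ d(a ⊕ b)`:
there are `e₀, e₁` with `B(e₀,e₁) = 1`, `B(a,b) = B(a,e₁)B(b,e₀) ⊕ B(a,e₀)B(b,e₁)` for all `a, b`, and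
`d ⊕ B(·,e₁)·B(·,e₀)` of degree `≤ 1` — i.e. `d = p·q ⊕ (affine)` with independent linear `p, q`.
ONE-SIDED; NOT summit progress. [this work] -/
theorem caseA_pq_structure (g : (Fin (7 + 7) → Bool) → Bool) (hg : IsDegLeFun 3 g)
    (u : (Fin (7 + 7) → Bool) → ℤ) (hu : ∀ x, W (fun y => signOf (g y)) x = (2 : ℝ) ^ 5 * (u x : ℝ))
    (hodd : ∀ x, Odd (u x)) (hA : ∀ x, ¬ (Odd (u x / 2) ↔ Odd (u x / 2 / 2))) :
    ∃ e₀ e₁ : Fin (7 + 7) → Bool,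
      (decide (Odd (u zeroVec / 2)) ^^ decide (Odd (u e₀ / 2)) ^^ decide (Odd (u e₁ / 2)) ^^
        decide (Odd (u (bxor e₀ e₁) / 2))) = true ∧
      (∀ a b : Fin (7 + 7) → Bool,
        (decide (Odd (u zeroVec / 2)) ^^ decide (Odd (u a / 2)) ^^ decide (Odd (u b / 2)) ^^
          decide (Odd (u (bxor a b) / 2))) =
        (((decide (Odd (u zeroVec / 2)) ^^ decide (Odd (u a / 2)) ^^ decide (Odd (u e₁ / 2)) ^^
            decide (Odd (u (bxor a e₁) / 2))) &&
          (decide (Odd (u zeroVec / 2)) ^^ decide (Odd (u b / 2)) ^^ decide (Odd (u e₀ / 2)) ^^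
            decide (Odd (u (bxor b e₀) / 2)))) ^^
         ((decide (Odd (u zeroVec / 2)) ^^ decide (Odd (u a / 2)) ^^ decide (Odd (u e₀ / 2)) ^^
            decide (Odd (u (bxor a e₀) / 2))) &&
          (decide (Odd (u zeroVec / 2)) ^^ decide (Odd (u b / 2)) ^^ decide (Odd (u e₁ / 2)) ^^
            decide (Odd (u (bxor b e₁) / 2)))))) ∧
      IsDegLeFun 1 (fun a => decide (Odd (u a / 2)) ^^
        ((decide (Odd (u zeroVec / 2)) ^^ decide (Odd (u a / 2)) ^^ decide (Odd (u e₁ / 2)) ^^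
            decide (Odd (u (bxor a e₁) / 2))) &&
         (decide (Odd (u zeroVec / 2)) ^^ decide (Odd (u a / 2)) ^^ decide (Odd (u e₀ / 2)) ^^
            decide (Odd (u (bxor a e₀) / 2))))) := by
  classical
  -- the digit and its symplectic form
  set d : (Fin (7 + 7) → Bool) → Bool := fun a => decide (Odd (u a / 2)) with hd
  have hd2 : IsDegLeFun 2 d := fd_digitOne g u hg hu
  set B : (Fin (7 + 7) → Bool) → (Fin (7 + 7) → Bool) → Bool := fun a b => d zeroVec ^^ d a ^^ d b ^^ d (bxor a b)
    with hB
  have hself : ∀ a, B a a = false := fun a => es_B_self d a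
  have hsymm : ∀ a b, B a b = B b a := fun a b => es_B_symm d a b
  have hadd : ∀ a a' b, B (bxor a a') b = (B a b ^^ B a' b) := fun a a' b => es_B_add_left d hd2 a a' b
  have hRad : 2 ^ (7 + 7) ≤ 4 * #(univ.filter fun a : Fin (7 + 7) → Bool => ∀ b, B a b = false) := by
    have h := caseA_radical_large g hg u hu hodd hA
    rw [show (2 : ℕ) ^ (7 + 7) = 4 * 2 ^ 12 from by norm_num]
    exact Nat.mul_le_mul_left 4 h
  -- a hyperbolic pair exists, since the digit is not affine
  have hex : ∃ e₀ e₁, B e₀ e₁ = true := by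
    by_contra hne
    push Not at hne
    have hz : ∀ a b, B a b = false := fun a b => by simpa using hne a b
    refine caseA_digit_not_affine g hg u hu hodd hA ?_
    have h1 : IsDegLeFun 1 (fun a => d a ^^ d zeroVec) := by
      refine isDegLeFun_one_of_additive fun a b => ?_
      have h := hz a b
      show (d (bxor a b) ^^ d zeroVec) = ((d a ^^ d zeroVec) ^^ (d b ^^ d zeroVec))
      change (d zeroVec ^^ d a ^^ d b ^^ d (bxor a b)) = false at h
      revert h
      cases d zeroVec <;> cases d a <;> cases d b <;> cases d (bxor a b) <;> decide
    have h2 := fc_deg_bxor h1 (isDegLeFun_const 1 (d zeroVec))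
    have heq : (fun a => (d a ^^ d zeroVec) ^^ d zeroVec) = d := by
      funext a
      cases d a <;> cases d zeroVec <;> rfl
    rw [heq] at h2
    exact h2
  obtain ⟨e₀, e₁, he⟩ := hex
  have hBeq := pq_B_eq B hsymm hself hadd e₀ e₁ he hRad
  refine ⟨e₀, e₁, he, hBeq, ?_⟩
  exact pq_mu_isDegLeFun_one d (fun a => B a e₁) (fun a => B a e₀) (fun a b => hadd a b e₁) (fun a b => hadd a b e₀)
    fun a b => hBeq a b

end Summit.QuantumAdvantage.QuantumAdvantage.Theorems.NearExactIsExact.Negative.CaseAPQStructureFourteen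

end
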